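import Summits.QuantumFields.BalabanUV.Beta.D1BFx.NeedleDipShape
import Summits.QuantumFields.BalabanUV.Beta.D1BFx.NeedleColumnLetters

/-!
# `BalabanUV.Beta.D1BFx.NeedleDipProjPointwise` — road «BF-x» for binder row D1, slot (K), END row `hGrp gN`, «GN-33 ∕ PK∕KP» PART 1: THE
# `dipPiece ⊗ projPiece` WORD OF THE GLUON NEEDLE ROW T₃ AS EIGHT PRODUCTS «pairing × point value» AND ITS POINTWISE BOUND IN THE THREE SHAPES
# `e`, `e∕nrm`, `e∕nrm²` FROM ABSTRACT LETTERS (the structural input of the two cells `hdp`, `hpd` of `GluonNeedleGlue.h₃_of_cells`)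

HONEST DEPENDENCY (cell records, verbatim): «continuum YM on T⁴ ⇐ BetaPertH ∧ nine spine estimates (0/9 proved); BetaPertH ⇐ (D1) ∧ (D4) ∧
CAP+tail; G-an2-4 gates asym, D1 and NE2/3/4.»  HONEST FRAMING (cell contract, verbatim): «discharging `BetaPertH` makes Bałaban's UV stability
UNCONDITIONAL — a real constructive-QFT result; it is NOT the continuum limit and NOT the Clay problem.»  THIS MODULE DISCHARGES NOTHING of the
wall: [folklore] kernel algebra and real bookkeeping BY NAME over leaf-04-g9's «GN-DIP-SHAPE» (`NeedleDipShape.dipPiece_eq_dSw_tensor`, the four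
localisations `locV_rho ∕ locV_drho ∕ locV_p ∕ locV_dp`), the owner's «GN-𝔅» word shape `RankOneBubbleJets.bubble_dSw_dJetSw` and the symmetry of the leg
action `NeedleColumnLetters.applyKT_eq_applyK_of_symm`.  No `def`, no `def … : Prop`, nothing cited, 0 sorry.  Asserts NO bound on any letter: the four
point values and the eight pairings are HYPOTHESES here (PART 2 `NeedleDipProjRow` instantiates them from the tree's letters).  Root-level binders
hW ∕ hR-sockets ∕ hSX-socket ∕ D1Tel ∕ D1Rep — 0 discharged; (K) NOT closed; NOT D1, NOT `BetaPertH`, NOT continuum, NOT Clay.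

ABSOLUTE RULE (cell charter, verbatim): «No internally-minted statement may enter as a cited fact. Every hypothesis is either kernel-proved in
this package or a verbatim quotation of a PUBLISHED theorem with page reference. The manuscript(s) under audit are NOT citable for their own
disputed steps — they are the thing under adjudication; programme-internal (2001/route/tribunal) claims are never citable.»

WHY (owner d1-p2 claim table «GN-CELLS» = `HOME/b2b-balaban-beta-d1-p2/GLUON-NEEDLE-ROWS.md` v0.2∕v0.3, cell PK∕KP «word shape `bubble_dSw_dJetSw` (point
values `(Ga∇f)(u,κ)`, pairings with `∇_row P`)»; RULINGS ρ-g10-5∕ρ-g10-6; owner d1-p2-g11 ONLINE 2026-08-21T12:33Z «PK∕KP: first refusal stands for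
leaf-04-g10»; an3-g59 `N36-SPLIT` §3′ (4) «PK c·n⁰»).  With `dipPiece n a κ u = dSw (δρ_u ⊗ p_u + ρ_u ⊗ δp_u − p_u ⊗ δρ_u − δp_u ⊗ ρ_u)` and
`projPiece n a κ′ v = dJetSw κ′ v (Pgt)` the word `bubble (Ga) (dip) (proj)` is the signed sum of four `dSw ⊗ dJetSw` words, i.e. EIGHT products
`⟨∇g, Ga∇c′⟩·(Ga∇f)(v,κ′) − (∇g Ga)(v,κ′)·⟨Ga∇f, ∇r′⟩` (`c′`∕`r′` the projector column∕row gradients at `v + e_κ′`); since `Ga` is symmetric the transposed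
point value `(∇g Ga)(v,κ′)` is again `(Ga∇g)(v,κ′)`.  Every one of the eight products contains exactly ONE point value `(Ga∇h)(v,κ′)`,
`h ∈ {p_u, δp_u, ρ_u, δρ_u}`, and these four are damped AT THE DIPOLE BOND `u` and read AT THE PROJECTOR BOND `v` (flat, flat, `e∕nrm`, `e∕nrm²`), so the
decay in `u − v` that the (1.22) sum needs comes from the point value alone and the eight pairings enter through their SUPS — no centre has to be moved.

CONTENT (`a > 0`, `n ≥ 1`; the four functions written inline as lambdas, as in `NeedleDipShape`).
* §1 [folklore] `abs_comb8_le` (real bookkeeping).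
* §2 [folklore] **`bubble_dip_dJetSw`** — `dip ⊗ dJetSw` over one spread leg and a spread partner kernel `Y`: four `bubble_dSw_dJetSw` words.
* §3 [folklore] **`abs_dipProj_word_le`** — from the four point-value letters `Pp`, `Pdp` (flat), `Pr` (`e∕nrm`), `Pdr` (`e∕nrm²`) at site rate `η∕n`
  and the eight pairing sups `S₁ … S₈`:
  `|bubble (Ga n a) (dipPiece n a κ u) (projPiece n a κ′ v)| ≤ (Pp·S₂ + Pdp·S₄ + S₅·Pp + S₇·Pdp)·e + (S₃·Pr + Pr·S₈)·e∕nrm(u−v) + (S₁·Pdr + Pdr·S₆)·e∕nrm(u−v)²`,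
  `e = e^{−(η∕n)‖u−v‖∞}`.
NOT HERE (honest): the letters themselves, the (1.22) sum, the base average, the weight `cK` (PART 2).
Unit `b2b-balaban-beta-d1-formalise-leaf-04` (gen 10); `LEAVES-BFx.md` row (N) «GN-33∕PK∕KP» PART 1.
-/

noncomputable section

namespace Summit.QuantumFields.BalabanUV.Beta.D1BFx.NeedleDipProjPointwise

open Finset
open scoped BigOperators
open Literature.MathematicalPhysics.QuantumFieldTheory.Balaban1983to89
open Literature.MathematicalPhysics.QuantumFieldTheory.Balaban1983to89.Beta
open ExpKernelCalculus (Site MKer bubble)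
open AffineAveraging (unitVec)
open PoissonInterior (nrm nrm_pos nrm_neg supNorm supNorm_neg)
open Summit.QuantumFields.BalabanUV.Beta.TameKernelCalculus (Spr Loc bubble_add_left)
open Summit.QuantumFields.BalabanUV.Beta.KernelWardRelative (bubble_sub_left)
open Summit.QuantumFields.BalabanUV.Beta.D1BFx.RProjector (Pgt deltaPP_pos)
open Summit.QuantumFields.BalabanUV.Beta.D1BFx.RJetProjector (decays_Pgt)
open Summit.QuantumFields.BalabanUV.Beta.D1BFx.GhostLeg (Ggh)
open Summit.QuantumFields.BalabanUV.Beta.D1BFx.RProjectorJet (RG)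
open Summit.QuantumFields.BalabanUV.Beta.D1BFx.GluonLeg (Ga)
open Summit.QuantumFields.BalabanUV.Beta.D1BFx.RJetAssembly (dSw dJetSw biLoc_dJetSw_of_decays)
open Summit.QuantumFields.BalabanUV.Beta.D1BFx.GluonNeedleSplit (dipPiece projPiece projPiece_apply dSw_add dSw_sub)
open Summit.QuantumFields.BalabanUV.Beta.D1BFx.RankOneBubble (applyK applyKT pairing)
open Summit.QuantumFields.BalabanUV.Beta.D1BFx.RankOneBubbleJets (grad tensor colGrad rowGrad loc_dSw_tensor bubble_dSw_dJetSw)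
open Summit.QuantumFields.BalabanUV.Beta.D1BFx.NeedleDipShape (dipPiece_eq_dSw_tensor locV_rho locV_drho locV_p locV_dp)
open Summit.QuantumFields.BalabanUV.Beta.D1BFx.NeedleColumnLetters (applyKT_eq_applyK_of_symm)

/-! ## §1 Real bookkeeping -/

/-- [folklore] `|a₁b₁ − c₁d₁ + (a₂b₂ − c₂d₂) − (a₃b₃ − c₃d₃) − (a₄b₄ − c₄d₄)| ≤ Σᵢ (|aᵢ||bᵢ| + |cᵢ||dᵢ|)`. -/
theorem abs_comb8_le (a₁ b₁ c₁ d₁ a₂ b₂ c₂ d₂ a₃ b₃ c₃ d₃ a₄ b₄ c₄ d₄ : ℝ) :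
    |a₁ * b₁ - c₁ * d₁ + (a₂ * b₂ - c₂ * d₂) - (a₃ * b₃ - c₃ * d₃) - (a₄ * b₄ - c₄ * d₄)|
      ≤ |a₁| * |b₁| + |c₁| * |d₁| + |a₂| * |b₂| + |c₂| * |d₂| + |a₃| * |b₃| + |c₃| * |d₃| + |a₄| * |b₄| + |c₄| * |d₄| := by
  calc |a₁ * b₁ - c₁ * d₁ + (a₂ * b₂ - c₂ * d₂) - (a₃ * b₃ - c₃ * d₃) - (a₄ * b₄ - c₄ * d₄)|
      ≤ |a₁ * b₁ - c₁ * d₁ + (a₂ * b₂ - c₂ * d₂) - (a₃ * b₃ - c₃ * d₃)| + |a₄ * b₄ - c₄ * d₄| := abs_sub _ _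
    _ ≤ |a₁ * b₁ - c₁ * d₁ + (a₂ * b₂ - c₂ * d₂)| + |a₃ * b₃ - c₃ * d₃| + |a₄ * b₄ - c₄ * d₄| := by
        gcongr; exact abs_sub _ _
    _ ≤ |a₁ * b₁ - c₁ * d₁| + |a₂ * b₂ - c₂ * d₂| + |a₃ * b₃ - c₃ * d₃| + |a₄ * b₄ - c₄ * d₄| := by
        gcongr; exact abs_add_le _ _
    _ ≤ (|a₁ * b₁| + |c₁ * d₁|) + (|a₂ * b₂| + |c₂ * d₂|) + (|a₃ * b₃| + |c₃ * d₃|) + (|a₄ * b₄| + |c₄ * d₄|) := by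
        gcongr <;> exact abs_sub _ _
    _ = _ := by simp only [abs_mul]; ring

variable (n : ℕ) [NeZero n] (a : ℝ) (κ : Fin 4) (u : Site 4)

/-! ## §2 The word shape `dip ⊗ dJetSw` -/

/-- [folklore] **`dip ⊗ dJetSw`** (the building block of the PK∕KP cells), over one spread leg `A` and a spread partner site kernel `Y`, `v′ = v + e_κ′`,
`c′ = ∇_col Y(·,v′)`, `r′ = ∇_row Y(v′,·)`; with `W(f,g) := ⟨∇g, A c′⟩·(A∇f)(v,κ′) − (∇g A)(v,κ′)·⟨A∇f, r′⟩`: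
`bubble A (dipPiece n a κ u) (dJetSw κ′ v Y) = W(δρ_u, p_u) + W(ρ_u, δp_u) − W(p_u, δρ_u) − W(δp_u, ρ_u)` (four `bubble_dSw_dJetSw` words). -/
theorem bubble_dip_dJetSw (ha : 0 < a) {A : MKer 4 (Fin 4)} (hA : Spr A) {Y : MKer 4 Unit} (hY : Spr Y) (κ' : Fin 4) (v : Site 4) :
    bubble A (dipPiece n a κ u) (dJetSw κ' v Y) =
      pairing (grad (fun q => Pgt n a u q () ())) (applyK A (colGrad Y (v + unitVec κ')))
            * applyK A (grad (fun x => RG (Ggh n a) (Pgt n a) x (u + unitVec κ) () () - RG (Ggh n a) (Pgt n a) x u () ())) v κ'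
          - applyKT (grad (fun q => Pgt n a u q () ())) A v κ'
            * pairing (applyK A (grad (fun x => RG (Ggh n a) (Pgt n a) x (u + unitVec κ) () () - RG (Ggh n a) (Pgt n a) x u () ())))
                (rowGrad Y (v + unitVec κ'))
        + (pairing (grad (fun q => Pgt n a u q () () - Pgt n a (u + unitVec κ) q () ())) (applyK A (colGrad Y (v + unitVec κ')))
              * applyK A (grad (fun x => RG (Ggh n a) (Pgt n a) x u () ())) v κ'
            - applyKT (grad (fun q => Pgt n a u q () () - Pgt n a (u + unitVec κ) q () ())) A v κ'
              * pairing (applyK A (grad (fun x => RG (Ggh n a) (Pgt n a) x u () ()))) (rowGrad Y (v + unitVec κ')))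
        - (pairing (grad (fun x => RG (Ggh n a) (Pgt n a) x (u + unitVec κ) () () - RG (Ggh n a) (Pgt n a) x u () ()))
                (applyK A (colGrad Y (v + unitVec κ'))) * applyK A (grad (fun q => Pgt n a u q () ())) v κ'
            - applyKT (grad (fun x => RG (Ggh n a) (Pgt n a) x (u + unitVec κ) () () - RG (Ggh n a) (Pgt n a) x u () ())) A v κ'
              * pairing (applyK A (grad (fun q => Pgt n a u q () ()))) (rowGrad Y (v + unitVec κ')))
        - (pairing (grad (fun x => RG (Ggh n a) (Pgt n a) x u () ())) (applyK A (colGrad Y (v + unitVec κ')))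
              * applyK A (grad (fun q => Pgt n a u q () () - Pgt n a (u + unitVec κ) q () ())) v κ'
            - applyKT (grad (fun x => RG (Ggh n a) (Pgt n a) x u () ())) A v κ'
              * pairing (applyK A (grad (fun q => Pgt n a u q () () - Pgt n a (u + unitVec κ) q () ()))) (rowGrad Y (v + unitVec κ'))) := by
  have h1 := locV_drho n a κ u ha
  have h2 := locV_rho n a u ha
  have h3 := locV_p n a u ha
  have h4 := locV_dp n a κ u ha
  have hP : Loc (dJetSw κ' v Y) := by
    obtain ⟨C, δ, hδ, hYd⟩ := hY
    exact ⟨v, v, _, δ, hδ, biLoc_dJetSw_of_decays κ' v hδ.le hYd⟩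
  have l13 := loc_dSw_tensor h1 h3
  have l24 := loc_dSw_tensor h2 h4
  have l31 := loc_dSw_tensor h3 h1
  have l42 := loc_dSw_tensor h4 h2
  rw [dipPiece_eq_dSw_tensor n a κ u, dSw_sub, dSw_sub, dSw_add,
    bubble_sub_left hA ((l13.add l24).sub l31) l42 hP, bubble_sub_left hA (l13.add l24) l31 hP, bubble_add_left hA l13 l24 hP,
    bubble_dSw_dJetSw hA hY h1 h3 κ' v, bubble_dSw_dJetSw hA hY h2 h4 κ' v, bubble_dSw_dJetSw hA hY h3 h1 κ' v,
    bubble_dSw_dJetSw hA hY h4 h2 κ' v]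

/-! ## §3 The pointwise bound of the `dip ⊗ proj` word from abstract letters -/

variable {n a κ u}

/-- [folklore] **THE `dip ⊗ proj` WORD, POINTWISE, FROM ABSTRACT LETTERS** (dipole at the bond `(u, κ)`, projector jet at `(v, κ′)`).  Letters: the four
POINT VALUES of the leg on the gradients of the dipole factors, damped at the dipole bond at site rate `η∕n` — `p_u`: `Pp·e`, `δp_u`: `Pdp·e` (flat),
`ρ_u`: `Pr·e∕nrm`, `δρ_u`: `Pdr·e∕nrm²` — and the eight PAIRING SUPS `S₁ … S₈` of those gradients against the projector column∕row gradients
`∇_col P(·,q)`, `∇_row P(p,·)` (any `p`, `q`).  Conclusion, with `e = e^{−(η∕n)‖u−v‖∞}`: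
`|bubble (Ga n a) (dipPiece n a κ u) (projPiece n a κ′ v)| ≤ (Pp·S₂ + Pdp·S₄ + S₅·Pp + S₇·Pdp)·e + (S₃·Pr + Pr·S₈)·e∕nrm(u−v) + (S₁·Pdr + Pdr·S₆)·e∕nrm(u−v)²`. -/
theorem abs_dipProj_word_le (ha : 0 < a) (hA : Spr (Ga n a)) {η Pp Pdp Pr Pdr S₁ S₂ S₃ S₄ S₅ S₆ S₇ S₈ : ℝ}
    (h0 : 0 ≤ Pp ∧ 0 ≤ Pdp ∧ 0 ≤ Pr ∧ 0 ≤ Pdr)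
    (hPp : ∀ (u x : Site 4) (c : Fin 4), |applyK (Ga n a) (grad (fun q => Pgt n a u q () ())) x c| ≤ Pp * Real.exp (-(η / n) * supNorm (x - u)))
    (hPdp : ∀ (u x : Site 4) (κ c : Fin 4), |applyK (Ga n a) (grad (fun q => Pgt n a u q () () - Pgt n a (u + unitVec κ) q () ())) x c|
      ≤ Pdp * Real.exp (-(η / n) * supNorm (x - u)))
    (hPr : ∀ (u x : Site 4) (c : Fin 4), |applyK (Ga n a) (grad (fun y => RG (Ggh n a) (Pgt n a) y u () ())) x c|
      ≤ Pr * Real.exp (-(η / n) * supNorm (x - u)) / nrm (x - u))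
    (hPdr : ∀ (u x : Site 4) (κ c : Fin 4),
      |applyK (Ga n a) (grad (fun y => RG (Ggh n a) (Pgt n a) y (u + unitVec κ) () () - RG (Ggh n a) (Pgt n a) y u () ())) x c|
        ≤ Pdr * Real.exp (-(η / n) * supNorm (x - u)) / nrm (x - u) ^ 2)
    (hS₁ : ∀ (u q : Site 4), |pairing (grad (fun q' => Pgt n a u q' () ())) (applyK (Ga n a) (colGrad (Pgt n a) q))| ≤ S₁)
    (hS₂ : ∀ (u p : Site 4) (κ : Fin 4),
      |pairing (applyK (Ga n a) (grad (fun y => RG (Ggh n a) (Pgt n a) y (u + unitVec κ) () () - RG (Ggh n a) (Pgt n a) y u () ())))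
        (rowGrad (Pgt n a) p)| ≤ S₂)
    (hS₃ : ∀ (u q : Site 4) (κ : Fin 4),
      |pairing (grad (fun q' => Pgt n a u q' () () - Pgt n a (u + unitVec κ) q' () ())) (applyK (Ga n a) (colGrad (Pgt n a) q))| ≤ S₃)
    (hS₄ : ∀ (u p : Site 4), |pairing (applyK (Ga n a) (grad (fun y => RG (Ggh n a) (Pgt n a) y u () ()))) (rowGrad (Pgt n a) p)| ≤ S₄)
    (hS₅ : ∀ (u q : Site 4) (κ : Fin 4),
      |pairing (grad (fun y => RG (Ggh n a) (Pgt n a) y (u + unitVec κ) () () - RG (Ggh n a) (Pgt n a) y u () ()))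
        (applyK (Ga n a) (colGrad (Pgt n a) q))| ≤ S₅)
    (hS₆ : ∀ (u p : Site 4), |pairing (applyK (Ga n a) (grad (fun q' => Pgt n a u q' () ()))) (rowGrad (Pgt n a) p)| ≤ S₆)
    (hS₇ : ∀ (u q : Site 4), |pairing (grad (fun y => RG (Ggh n a) (Pgt n a) y u () ())) (applyK (Ga n a) (colGrad (Pgt n a) q))| ≤ S₇)
    (hS₈ : ∀ (u p : Site 4) (κ : Fin 4),
      |pairing (applyK (Ga n a) (grad (fun q' => Pgt n a u q' () () - Pgt n a (u + unitVec κ) q' () ()))) (rowGrad (Pgt n a) p)| ≤ S₈)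
    (κ κ' : Fin 4) (u v : Site 4) :
    |bubble (Ga n a) (dipPiece n a κ u) (projPiece n a κ' v)| ≤
      (Pp * S₂ + Pdp * S₄ + S₅ * Pp + S₇ * Pdp) * Real.exp (-(η / n) * supNorm (u - v))
        + (S₃ * Pr + Pr * S₈) * Real.exp (-(η / n) * supNorm (u - v)) / nrm (u - v)
        + (S₁ * Pdr + Pdr * S₆) * Real.exp (-(η / n) * supNorm (u - v)) / nrm (u - v) ^ 2 := by
  obtain ⟨h0p, h0dp, h0r, h0dr⟩ := h0
  have hn : (0 : ℝ) < n := by exact_mod_cast Nat.pos_of_ne_zero (NeZero.ne n)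
  have hP : Spr (Pgt n a) := ⟨_, _, div_pos (deltaPP_pos 4 ha) (mul_pos (by norm_num) hn), decays_Pgt n a ha⟩
  rw [projPiece_apply, bubble_dip_dJetSw n a κ u ha hA hP κ' v, applyKT_eq_applyK_of_symm a ha n, applyKT_eq_applyK_of_symm a ha n,
    applyKT_eq_applyK_of_symm a ha n, applyKT_eq_applyK_of_symm a ha n]
  -- the decay factor and the symmetric readings
  set E : ℝ := Real.exp (-(η / n) * supNorm (u - v)) with hE
  have hE0 : 0 ≤ E := (Real.exp_pos _).le
  have esym : Real.exp (-(η / n) * supNorm (v - u)) = E := by rw [hE, ← neg_sub u v, supNorm_neg]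
  have nsym : nrm (v - u) = nrm (u - v) := by rw [← neg_sub u v, nrm_neg]
  have hnrm := nrm_pos (d := 4) (u - v)
  -- the four point values at the projector bond
  have qp := hPp u v κ'
  have qdp := hPdp u v κ κ'
  have qr := hPr u v κ'
  have qdr := hPdr u v κ κ'
  rw [esym] at qp qdp qr qdr
  rw [nsym] at qr qdr
  -- the eight pairings
  have s₁ := hS₁ u (v + unitVec κ')
  have s₂ := hS₂ u (v + unitVec κ') κ
  have s₃ := hS₃ u (v + unitVec κ') κ
  have s₄ := hS₄ u (v + unitVec κ')
  have s₅ := hS₅ u (v + unitVec κ') κ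
  have s₆ := hS₆ u (v + unitVec κ')
  have s₇ := hS₇ u (v + unitVec κ')
  have s₈ := hS₈ u (v + unitVec κ') κ
  have t0 : ∀ {x y X Y : ℝ}, |x| ≤ X → |y| ≤ Y → |x| * |y| ≤ X * Y := fun hx hy =>
    mul_le_mul hx hy (abs_nonneg _) ((abs_nonneg _).trans hx)
  refine (abs_comb8_le _ _ _ _ _ _ _ _ _ _ _ _ _ _ _ _).trans ?_
  have := add_le_add (add_le_add (add_le_add (add_le_add (add_le_add (add_le_add (add_le_add (t0 s₁ qdr) (t0 qp s₂)) (t0 s₃ qr)) (t0 qdp s₄))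
    (t0 s₅ qp)) (t0 qdr s₆)) (t0 s₇ qdp)) (t0 qr s₈)
  refine this.trans (le_of_eq ?_)
  ring

end Summit.QuantumFields.BalabanUV.Beta.D1BFx.NeedleDipProjPointwise

end
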